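import Summits.QuantumFields.YangMills.Theorems.UnitScaleTiltProp7CovariantTransport
import HarnessLib

/-!
# Route `UnitScaleTilt`, crux K1 child «MinimiserStabilityRegPr» (stmt-QuantumFields-19200), registered stub `stub_prop7From14` (v4 828f5fb4a904d3be;
# leaf V3 «Prop 7 from a background (14)» = `T3Thm1CarrierNative.Prop7From14At`) — sub-lemma V3-D2, part 2/3: THE COMB-GAUGE BLOCK POINCARÉ INEQUALITY AND THE
# COVARIANT BLOCK MEAN AGAINST THE COVARIANT STRAIGHT-LINE BLOCK AVERAGE, on one block `B^e(y)` of the fine torus, at a unitary background with small plaquettes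

Cell `ym3-torus` ∕ fleet seat `ym-ust-19200-p1` (HUMAN RULING D-0037, YM ladder rung R3), successor g2.  The two per-block estimates from which the sequel
`UnitScaleTiltProp7CovariantCoercivity` assembles the non-flat, `k`-uniform Poincaré–coercivity of the straight-line block averaging ([Balaban1985BackgroundPropagators]
Thm 3.11's averaging term at a background of [Balaban1985Variational] (14)).  The block is parametrised by its offsets `r ∈ {0,…,n}^d` (`n + 1 = L^e`, the tree's
`B5Leaf237C0Torus.bsite`), the gauge is the comb (axial) gauge from the block corner `ȳ` (`v_r = V(Γ_{ȳ,x_r})`, `B7Prop1Explicit.treeWord` ∕ `B10Eq27TorusAxialLog.holT`).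

WHAT IS PROVED (sorry-free, no definition; our own statements — [folklore] ∕ cited to the printed step they instantiate):
* §3 `block227_matrix` — the tree's cube Poincaré inequality `B4Block227.block227_real` ((2.27) of [Balaban1983RegularityDecay], constant 8) for `M_N(ℂ)`-valued
  functions (summed over the `2N²` real components, operator norm): `8Σ_r‖F(r)‖² ≤ N(n+1)²Σ_μΣ_{r_μ<n}‖F(r+e_μ) − F(r)‖² + 8N(n+1)^{−d}‖Σ_rF(r)‖²`;
  **`block_poincare_comb`** — ITS COMB-GAUGE (COVARIANT) FORM: for `V` with plaquette variables within `a` of `1`,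
  `Σ_B‖f‖² ≤ (N/4)(L^e)²·Σ_{intra-block bonds}‖∇^V f‖² + N·d(dna)²(L^e)²·Σ_B‖f‖² + N·L^{−ed}·‖Σ_{x∈B} R(V(Γ_{ȳ,x}))f(x)‖²`
  (the flat inequality for the comb-transported field, whose flat differences are covariant derivatives up to the axial-gauge defect `≤ |x − ȳ|₁a ≤ dna`,
  part 1's `norm_conjR_comb_sub_le`);
* §4 **`blockMean_cov_le`** (covariant twin of `Prop7FlatCoercivity.blockMean_sq_le`): `L^{−ed}‖Σ_r R(v_r)f(x_r)‖² ≤ 2(L^{ed}L^{2e})^{−1}‖Σ_rΣ_{t<L^e}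
  R(v_r·V([x_r,x_r+te_μ]))f(x_r+te_μ)‖² + 2L^e·Σ_{s<L^e}Σ_r‖(∇^V_μ f)(x_r+se_μ)‖²` — the block mean differs from the covariant straight-line block average by the
  telescoped covariant `μ`-derivatives along the contours ([Balaban1984PropagatorsI] (1.18)), Cauchy–Schwarz.

References: T. Bałaban, CMP 89 (1983) 571–597 [Balaban1983RegularityDecay] ((2.27) p.580); CMP 95 (1984) 17–40 [Balaban1984PropagatorsI] ((1.18) p.20, Prop. 1.1
(1.90) p.33); CMP 98 (1985) 17–51 [Balaban1985Averaging] (pp.24–25); CMP 99 (1985) 75–102 [Balaban1985RegularSpaces] ((1.1) p.76); CMP 99 (1985) 389–434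
[Balaban1985BackgroundPropagators] (Thm 3.11 p.416).
-/

noncomputable section

open scoped BigOperators Matrix.Norms.L2Operator

namespace Summit.QuantumFields.YangMills.Theorems.Prop7CovariantCoercivity

open Literature.MathematicalPhysics.QuantumFieldTheory.Balaban1983to89
open Finset B1RG242Torus
open B7Prop1Explicit renaming Site → LSite
open B7Prop1Explicit (Letter e hol treeWord axialFn disp plaqWord l1 U1 hol_append disp_treeWord gaugeAct axial_bond_bound hol_mem
  disp_replicate)
open B7Eq78Linearization (conjR conjR_apply conjR_sub conjR_add)
open B8Ineq132 (norm_conjR conjR_conjR one_conjR)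
open B10Eq27TorusAxialLog (transl transl_zero transl_add transl_add_e pull pull_apply holT holT_append hol_pull hol_pull_zero holT_nil
  holT_cons_true)

variable {N : ℕ} [NeZero N]

/-! ## §3 The block Poincaré inequality for matrix-valued functions and its comb-gauge (covariant) form -/

section Block

open Beta.CoordCubePoincare (stepUp)
open B5Leaf237C0Torus (bsite bsite_stepUp sum_bsite proj_bsite)

omit [NeZero N] in
/-- Moving a double component sum inside a finite sum (bookkeeping). [folklore] -/
theorem sum_sum_sum_comm {ι : Type*} (s : Finset ι) (T : ι → Fin N → Fin N → ℝ) :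
    ∑ j : Fin N, ∑ k : Fin N, ∑ x ∈ s, T x j k = ∑ x ∈ s, ∑ j : Fin N, ∑ k : Fin N, T x j k :=
  (Finset.sum_congr rfl fun _ _ => Finset.sum_comm).trans Finset.sum_comm

omit [NeZero N] in
/-- **THE CUBE POINCARÉ INEQUALITY FOR `M_N(ℂ)`-VALUED FUNCTIONS** (tree `B4Block227.block227_real`, constant `8`, summed over the `2N²` real components and
compared with the operator norm): for `F` on the cube `{0,…,n}^D`,
`8·Σ_r ‖F(r)‖² ≤ N(n+1)²·Σ_μ Σ_{r_μ<n} ‖F(r+e_μ) − F(r)‖² + 8N(n+1)^{−D}·‖Σ_r F(r)‖²`. [cite: Balaban1983RegularityDecay, (2.27) p.580] -/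
theorem block227_matrix (n D : ℕ) (F : (Fin D → Fin (n + 1)) → Matrix (Fin N) (Fin N) ℂ) :
    8 * ∑ r, ‖F r‖ ^ 2
      ≤ N * ((n : ℝ) + 1) ^ 2 * ∑ μ : Fin D, ∑ r ∈ univ.filter (fun r : Fin D → Fin (n + 1) => r μ ≠ Fin.last n), ‖F (stepUp r μ) - F r‖ ^ 2
        + 8 * N * (((n : ℝ) + 1) ^ D)⁻¹ * ‖∑ r, F r‖ ^ 2 := by
  -- real-valued bookkeeping functions (no matrix coercions inside the sums to be commuted)
  set A : (Fin D → Fin (n + 1)) → Fin N → Fin N → ℝ := fun r j k => (F r j k).re ^ 2 + (F r j k).im ^ 2 with hA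
  set B : Fin D → (Fin D → Fin (n + 1)) → Fin N → Fin N → ℝ :=
    fun μ r j k => ((F (stepUp r μ) - F r) j k).re ^ 2 + ((F (stepUp r μ) - F r) j k).im ^ 2 with hB
  set C : Fin N → Fin N → ℝ := fun j k => ((∑ r, F r) j k).re ^ 2 + ((∑ r, F r) j k).im ^ 2 with hC
  -- the real components
  have key : ∀ j k : Fin N,
      8 * ∑ r, A r j k
        ≤ ((n : ℝ) + 1) ^ 2 * ∑ μ : Fin D, ∑ r ∈ univ.filter (fun r : Fin D → Fin (n + 1) => r μ ≠ Fin.last n), B μ r j k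
          + 8 * (((n : ℝ) + 1) ^ D)⁻¹ * C j k := by
    intro j k
    have hre := B4Block227.block227_real n D 8 (fun r => (F r j k).re)
    have him := B4Block227.block227_real n D 8 (fun r => (F r j k).im)
    rw [min_self] at hre him
    simp only [hA, hB, hC, Matrix.sub_apply, Complex.sub_re, Complex.sub_im, Matrix.sum_apply, Complex.re_sum, Complex.im_sum,
      Finset.sum_add_distrib, mul_add]
    linarith
  -- sum over the components
  have hsum : ∑ j : Fin N, ∑ k : Fin N, 8 * ∑ r, A r j k
      ≤ ∑ j : Fin N, ∑ k : Fin N, (((n : ℝ) + 1) ^ 2 * ∑ μ : Fin D, ∑ r ∈ univ.filter (fun r : Fin D → Fin (n + 1) => r μ ≠ Fin.last n), B μ r j k)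
        + ∑ j : Fin N, ∑ k : Fin N, (8 * (((n : ℝ) + 1) ^ D)⁻¹ * C j k) := by
    rw [← Finset.sum_add_distrib]
    refine Finset.sum_le_sum fun j _ => ?_
    rw [← Finset.sum_add_distrib]
    exact Finset.sum_le_sum fun k _ => key j k
  -- pull the constants and commute the component sums inside
  have e1 : ∑ j : Fin N, ∑ k : Fin N, 8 * ∑ r, A r j k = 8 * ∑ r, ∑ j : Fin N, ∑ k : Fin N, A r j k := by
    rw [← sum_sum_sum_comm, Finset.mul_sum]
    exact Finset.sum_congr rfl fun j _ => by rw [Finset.mul_sum]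
  have e2 : ∑ j : Fin N, ∑ k : Fin N, (((n : ℝ) + 1) ^ 2 * ∑ μ : Fin D, ∑ r ∈ univ.filter (fun r : Fin D → Fin (n + 1) => r μ ≠ Fin.last n), B μ r j k)
      = ((n : ℝ) + 1) ^ 2 * ∑ μ : Fin D, ∑ r ∈ univ.filter (fun r : Fin D → Fin (n + 1) => r μ ≠ Fin.last n), ∑ j : Fin N, ∑ k : Fin N, B μ r j k := by
    have : ∑ μ : Fin D, ∑ r ∈ univ.filter (fun r : Fin D → Fin (n + 1) => r μ ≠ Fin.last n), ∑ j : Fin N, ∑ k : Fin N, B μ r j k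
        = ∑ j : Fin N, ∑ k : Fin N, ∑ μ : Fin D, ∑ r ∈ univ.filter (fun r : Fin D → Fin (n + 1) => r μ ≠ Fin.last n), B μ r j k := by
      rw [sum_sum_sum_comm]
      exact Finset.sum_congr rfl fun μ _ => by rw [sum_sum_sum_comm]
    rw [this, Finset.mul_sum]
    exact Finset.sum_congr rfl fun j _ => by rw [Finset.mul_sum]
  have e3 : ∑ j : Fin N, ∑ k : Fin N, (8 * (((n : ℝ) + 1) ^ D)⁻¹ * C j k) = 8 * (((n : ℝ) + 1) ^ D)⁻¹ * ∑ j : Fin N, ∑ k : Fin N, C j k := by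
    rw [Finset.mul_sum]
    exact Finset.sum_congr rfl fun j _ => by rw [Finset.mul_sum]
  rw [e1, e2, e3] at hsum
  -- compare with the operator norms
  have hL : ∑ r, ‖F r‖ ^ 2 ≤ ∑ r, ∑ j : Fin N, ∑ k : Fin N, A r j k :=
    Finset.sum_le_sum fun r _ => opNorm_sq_le_sum_re_sq_add_im_sq (F r)
  have hR1 : ∑ μ : Fin D, ∑ r ∈ univ.filter (fun r : Fin D → Fin (n + 1) => r μ ≠ Fin.last n), ∑ j : Fin N, ∑ k : Fin N, B μ r j k
      ≤ ∑ μ : Fin D, ∑ r ∈ univ.filter (fun r : Fin D → Fin (n + 1) => r μ ≠ Fin.last n), (N * ‖F (stepUp r μ) - F r‖ ^ 2) :=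
    Finset.sum_le_sum fun μ _ => Finset.sum_le_sum fun r _ => sum_re_sq_add_im_sq_le_mul_opNorm_sq _
  have hR1' : ∑ μ : Fin D, ∑ r ∈ univ.filter (fun r : Fin D → Fin (n + 1) => r μ ≠ Fin.last n), (N * ‖F (stepUp r μ) - F r‖ ^ 2)
      = N * ∑ μ : Fin D, ∑ r ∈ univ.filter (fun r : Fin D → Fin (n + 1) => r μ ≠ Fin.last n), ‖F (stepUp r μ) - F r‖ ^ 2 := by
    rw [Finset.mul_sum]
    exact Finset.sum_congr rfl fun μ _ => by rw [Finset.mul_sum]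
  have hR2 : ∑ j : Fin N, ∑ k : Fin N, C j k ≤ N * ‖∑ r, F r‖ ^ 2 := sum_re_sq_add_im_sq_le_mul_opNorm_sq _
  have hn0 : (0 : ℝ) ≤ ((n : ℝ) + 1) ^ 2 := by positivity
  have hw0 : (0 : ℝ) ≤ 8 * (((n : ℝ) + 1) ^ D)⁻¹ := by positivity
  have := mul_le_mul_of_nonneg_left (hR1.trans hR1'.le) hn0
  have := mul_le_mul_of_nonneg_left hR2 hw0
  nlinarith [hL]

variable {P : Params} {i i' e n : ℕ}

omit [NeZero N] in
/-- The block site with offset `r` is the translate of the block corner by the integer vector `r`. [folklore] -/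
theorem bsite_eq_transl (hn : n + 1 = P.L ^ e) (y : Site P i') (r : Fin P.d → Fin (n + 1)) :
    bsite P i e hn y r = transl (bsite P i e hn y fun _ => 0) (fun ν => ((r ν : ℕ) : ℤ)) := by
  funext ν
  simp only [bsite, Site.fibreSite, B10Eq27TorusAxialLog.transl_apply, Fin.val_cast, Fin.val_zero, add_zero, Int.cast_natCast]
  push_cast
  ring

omit [NeZero N] in
/-- Inside the cube, the offset of `r + e_μ` is the offset of `r` plus `e_μ`. [folklore] -/
theorem intVec_stepUp {d : ℕ} (r : Fin d → Fin (n + 1)) (μ : Fin d) (hr : r μ ≠ Fin.last n) :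
    (fun ν => (((stepUp r μ) ν : ℕ) : ℤ)) = (fun ν => ((r ν : ℕ) : ℤ)) + B7Prop1Explicit.e μ := by
  funext ν
  simp only [stepUp, Pi.add_apply, B7Prop1Explicit.e_apply]
  by_cases hν : ν = μ
  · subst hν
    rw [Function.update_self, if_pos rfl, Fin.val_add_one_of_lt (Fin.lt_last_iff_ne_last.mpr hr)]
    push_cast; ring
  · rw [Function.update_of_ne hν, if_neg hν, add_zero]

omit [NeZero N] in
/-- The `ℓ¹` length of a cube offset is at most `d·n`. [folklore] -/
theorem l1_intVec_le {d : ℕ} (r : Fin d → Fin (n + 1)) : (l1 (fun ν => ((r ν : ℕ) : ℤ)) : ℝ) ≤ d * n := by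
  have h : ∀ ν, ((r ν : ℕ) : ℤ).natAbs ≤ n := fun ν => by rw [Int.natAbs_natCast]; exact Nat.lt_succ_iff.mp (r ν).isLt
  have : l1 (fun ν => ((r ν : ℕ) : ℤ)) ≤ d * n := by
    unfold l1
    calc ∑ ν, ((r ν : ℕ) : ℤ).natAbs ≤ ∑ _ν : Fin d, n := Finset.sum_le_sum fun ν _ => h ν
      _ = d * n := by simp
  exact_mod_cast this

/-- **THE COMB-GAUGE BLOCK POINCARÉ INEQUALITY** (the covariant form of [Balaban1983RegularityDecay] (2.27) on one block `B^e(y)` of side `L^e = n+1`):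
for a unitary background `V` whose plaquette variables are within `a` of `1` and every `M_N(ℂ)`-valued `f` on the fine torus,
`Σ_{x∈B(y)} ‖f(x)‖² ≤ (N/4)(L^e)²·Σ_ν Σ_{x, x+e_ν ∈ B(y)} ‖(∇^V_ν f)(x)‖² + N·d³n²a²(L^e)²·Σ_{x∈B(y)} ‖f(x)‖² + N·L^{−ed}·‖Σ_{x∈B(y)} R(V(Γ_{ȳ,x}))f(x)‖²`,
`ȳ` the block corner, `Γ_{ȳ,x}` the comb contour, `R(u)X = uXu⁻¹`, `∇^V_ν` the forward covariant derivative: the flat cube inequality applied to the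
comb-transported field `x ↦ R(V(Γ_{ȳ,x}))f(x)`, whose flat differences are covariant derivatives up to the axial-gauge defect `≤ |x − ȳ|₁·a ≤ dn·a`.
[cite: Balaban1985Averaging, pp.24–25; Balaban1983RegularityDecay, (2.27) p.580] -/
theorem block_poincare_comb {V : GaugeField P i (Matrix (Fin N) (Fin N) ℂ)ˣ} (hV : ∀ b, V b ∈ U1 (Matrix (Fin N) (Fin N) ℂ)) {a : ℝ}
    (ha : 0 ≤ a) (hplaq : ∀ (x : Site P i) (κ μ : Fin P.d), κ ≠ μ → ‖((holT V x (plaqWord κ μ) : (Matrix (Fin N) (Fin N) ℂ)ˣ) : Matrix (Fin N) (Fin N) ℂ) - 1‖ ≤ a)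
    (hn : n + 1 = P.L ^ e) (y : Site P i') (f : Site P i → Matrix (Fin N) (Fin N) ℂ) :
    ∑ r : Fin P.d → Fin (n + 1), ‖f (bsite P i e hn y r)‖ ^ 2
      ≤ (N / 4) * ((n : ℝ) + 1) ^ 2 * ∑ ν : Fin P.d, ∑ r ∈ univ.filter (fun r : Fin P.d → Fin (n + 1) => r ν ≠ Fin.last n),
            ‖conjR (V ⟨bsite P i e hn y r, ν⟩) (f ((bsite P i e hn y r).shift ν)) - f (bsite P i e hn y r)‖ ^ 2
        + N * (P.d * ((P.d * n * a) ^ 2 * ((n : ℝ) + 1) ^ 2)) * ∑ r : Fin P.d → Fin (n + 1), ‖f (bsite P i e hn y r)‖ ^ 2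
        + N * (((n : ℝ) + 1) ^ P.d)⁻¹ *
            ‖∑ r : Fin P.d → Fin (n + 1), conjR (holT V (bsite P i e hn y fun _ => 0) (treeWord fun ν => ((r ν : ℕ) : ℤ))) (f (bsite P i e hn y r))‖ ^ 2 := by
  set ybar : Site P i := bsite P i e hn y fun _ => 0 with hybar
  set F : (Fin P.d → Fin (n + 1)) → Matrix (Fin N) (Fin N) ℂ :=
    fun r => conjR (holT V ybar (treeWord fun ν => ((r ν : ℕ) : ℤ))) (f (bsite P i e hn y r)) with hF
  set θ : ℝ := P.d * n * a with hθ
  have hθ0 : 0 ≤ θ := by positivity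
  have h227 := block227_matrix n P.d F
  -- `‖F r‖ = ‖f x_r‖`
  have hFn : ∀ r, ‖F r‖ = ‖f (bsite P i e hn y r)‖ := fun r => norm_conjR (holT_mem hV _ _) _
  -- the differences
  have hΔ : ∀ (ν : Fin P.d) (r : Fin P.d → Fin (n + 1)), r ν ≠ Fin.last n →
      ‖F (stepUp r ν) - F r‖ ^ 2
        ≤ 2 * ‖conjR (V ⟨bsite P i e hn y r, ν⟩) (f ((bsite P i e hn y r).shift ν)) - f (bsite P i e hn y r)‖ ^ 2
          + 8 * θ ^ 2 * ‖f (bsite P i e hn y r)‖ ^ 2 := by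
    intro ν r hr
    have h1 := norm_conjR_comb_sub_le hV ha hplaq ybar (fun κ => ((r κ : ℕ) : ℤ)) ν (f (bsite P i e hn y r)) (f ((bsite P i e hn y r).shift ν))
    rw [← intVec_stepUp r ν hr, ← bsite_eq_transl hn y r] at h1
    have hFs : F (stepUp r ν) = conjR (holT V ybar (treeWord fun κ => (((stepUp r ν) κ : ℕ) : ℤ))) (f ((bsite P i e hn y r).shift ν)) := by
      simp only [hF]; rw [bsite_stepUp P hn y r ν hr]
    have hFr : F r = conjR (holT V ybar (treeWord fun κ => ((r κ : ℕ) : ℤ))) (f (bsite P i e hn y r)) := rfl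
    rw [← hFs, ← hFr] at h1
    have h2 : (l1 (fun κ => ((r κ : ℕ) : ℤ)) : ℝ) * a ≤ θ := by
      rw [hθ]; exact mul_le_mul_of_nonneg_right (l1_intVec_le r) ha
    have hX : 0 ≤ ‖f (bsite P i e hn y r)‖ := norm_nonneg _
    have hD : 0 ≤ ‖conjR (V ⟨bsite P i e hn y r, ν⟩) (f ((bsite P i e hn y r).shift ν)) - f (bsite P i e hn y r)‖ := norm_nonneg _
    have h3 : ‖F (stepUp r ν) - F r‖ ≤ ‖conjR (V ⟨bsite P i e hn y r, ν⟩) (f ((bsite P i e hn y r).shift ν)) - f (bsite P i e hn y r)‖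
        + 2 * θ * ‖f (bsite P i e hn y r)‖ := by
      refine h1.trans ?_
      nlinarith [mul_le_mul_of_nonneg_right h2 hX]
    have h4 : 0 ≤ ‖F (stepUp r ν) - F r‖ := norm_nonneg _
    nlinarith [h3, sq_nonneg (‖conjR (V ⟨bsite P i e hn y r, ν⟩) (f ((bsite P i e hn y r).shift ν)) - f (bsite P i e hn y r)‖ - 2 * θ * ‖f (bsite P i e hn y r)‖)]
  -- sum the differences
  have hG : ∑ ν : Fin P.d, ∑ r ∈ univ.filter (fun r : Fin P.d → Fin (n + 1) => r ν ≠ Fin.last n), ‖F (stepUp r ν) - F r‖ ^ 2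
      ≤ 2 * ∑ ν : Fin P.d, ∑ r ∈ univ.filter (fun r : Fin P.d → Fin (n + 1) => r ν ≠ Fin.last n),
            ‖conjR (V ⟨bsite P i e hn y r, ν⟩) (f ((bsite P i e hn y r).shift ν)) - f (bsite P i e hn y r)‖ ^ 2
        + 8 * θ ^ 2 * (P.d * ∑ r : Fin P.d → Fin (n + 1), ‖f (bsite P i e hn y r)‖ ^ 2) := by
    have hs : ∀ ν : Fin P.d, ∑ r ∈ univ.filter (fun r : Fin P.d → Fin (n + 1) => r ν ≠ Fin.last n), ‖F (stepUp r ν) - F r‖ ^ 2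
        ≤ 2 * ∑ r ∈ univ.filter (fun r : Fin P.d → Fin (n + 1) => r ν ≠ Fin.last n),
              ‖conjR (V ⟨bsite P i e hn y r, ν⟩) (f ((bsite P i e hn y r).shift ν)) - f (bsite P i e hn y r)‖ ^ 2
          + 8 * θ ^ 2 * ∑ r : Fin P.d → Fin (n + 1), ‖f (bsite P i e hn y r)‖ ^ 2 := by
      intro ν
      have step1 : ∑ r ∈ univ.filter (fun r : Fin P.d → Fin (n + 1) => r ν ≠ Fin.last n), ‖F (stepUp r ν) - F r‖ ^ 2
          ≤ ∑ r ∈ univ.filter (fun r : Fin P.d → Fin (n + 1) => r ν ≠ Fin.last n),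
              (2 * ‖conjR (V ⟨bsite P i e hn y r, ν⟩) (f ((bsite P i e hn y r).shift ν)) - f (bsite P i e hn y r)‖ ^ 2
                + 8 * θ ^ 2 * ‖f (bsite P i e hn y r)‖ ^ 2) :=
        Finset.sum_le_sum fun r hr => hΔ ν r (Finset.mem_filter.mp hr).2
      have step2 : ∑ r ∈ univ.filter (fun r : Fin P.d → Fin (n + 1) => r ν ≠ Fin.last n),
              (2 * ‖conjR (V ⟨bsite P i e hn y r, ν⟩) (f ((bsite P i e hn y r).shift ν)) - f (bsite P i e hn y r)‖ ^ 2
                + 8 * θ ^ 2 * ‖f (bsite P i e hn y r)‖ ^ 2)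
          = 2 * ∑ r ∈ univ.filter (fun r : Fin P.d → Fin (n + 1) => r ν ≠ Fin.last n),
              ‖conjR (V ⟨bsite P i e hn y r, ν⟩) (f ((bsite P i e hn y r).shift ν)) - f (bsite P i e hn y r)‖ ^ 2
            + 8 * θ ^ 2 * ∑ r ∈ univ.filter (fun r : Fin P.d → Fin (n + 1) => r ν ≠ Fin.last n), ‖f (bsite P i e hn y r)‖ ^ 2 := by
        rw [Finset.sum_add_distrib, Finset.mul_sum, Finset.mul_sum]
      have step3 : ∑ r ∈ univ.filter (fun r : Fin P.d → Fin (n + 1) => r ν ≠ Fin.last n), ‖f (bsite P i e hn y r)‖ ^ 2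
          ≤ ∑ r : Fin P.d → Fin (n + 1), ‖f (bsite P i e hn y r)‖ ^ 2 :=
        Finset.sum_le_sum_of_subset_of_nonneg (Finset.filter_subset _ _) fun _ _ _ => sq_nonneg _
      have hθ2 : 0 ≤ 8 * θ ^ 2 := by positivity
      linarith [step1, step2, mul_le_mul_of_nonneg_left step3 hθ2]
    calc _ ≤ ∑ ν : Fin P.d, (2 * ∑ r ∈ univ.filter (fun r : Fin P.d → Fin (n + 1) => r ν ≠ Fin.last n),
              ‖conjR (V ⟨bsite P i e hn y r, ν⟩) (f ((bsite P i e hn y r).shift ν)) - f (bsite P i e hn y r)‖ ^ 2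
            + 8 * θ ^ 2 * ∑ r : Fin P.d → Fin (n + 1), ‖f (bsite P i e hn y r)‖ ^ 2) := Finset.sum_le_sum fun ν _ => hs ν
      _ = _ := by rw [Finset.sum_add_distrib, ← Finset.mul_sum, Finset.sum_const, Finset.card_univ, Fintype.card_fin, nsmul_eq_mul]; ring
  -- assemble
  have hLHS : ∑ r, ‖F r‖ ^ 2 = ∑ r : Fin P.d → Fin (n + 1), ‖f (bsite P i e hn y r)‖ ^ 2 := Finset.sum_congr rfl fun r _ => by rw [hFn]
  rw [hLHS] at h227
  have hN0 : (0 : ℝ) ≤ N * ((n : ℝ) + 1) ^ 2 := by positivity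
  have hm := mul_le_mul_of_nonneg_left hG hN0
  have hθ' : N * (P.d * ((P.d * n * a) ^ 2 * ((n : ℝ) + 1) ^ 2)) * ∑ r : Fin P.d → Fin (n + 1), ‖f (bsite P i e hn y r)‖ ^ 2
      = (N * ((n : ℝ) + 1) ^ 2 * (8 * θ ^ 2 * (P.d * ∑ r : Fin P.d → Fin (n + 1), ‖f (bsite P i e hn y r)‖ ^ 2))) / 8 := by
    rw [hθ]; ring
  rw [hθ']
  linarith [h227, hm]

end Block


/-! ## §4 The covariant block mean versus the covariant straight-line block average (telescoping along the contour) -/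

section LineAverage

open Beta.CoordCubePoincare (stepUp)
open B5Leaf237C0Torus (bsite bsite_stepUp sum_bsite proj_bsite)

variable {P : Params} {i i' e n : ℕ}

omit [NeZero N] in
/-- `‖(m : ℕ) • X‖ = m·‖X‖` in `M_N(ℂ)`. [folklore] -/
theorem norm_nsmul_eq (m : ℕ) (X : Matrix (Fin N) (Fin N) ℂ) : ‖m • X‖ = (m : ℝ) * ‖X‖ := by
  rw [← Nat.cast_smul_eq_nsmul ℝ, norm_smul, Real.norm_natCast]

/-- **ONE BLOCK, ONE DIRECTION — THE COMB-GAUGE BLOCK MEAN IS CONTROLLED BY THE COVARIANT STRAIGHT-LINE BLOCK AVERAGE AND THE COVARIANT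
`μ`-DERIVATIVES** (covariant twin of `Prop7FlatCoercivity.blockMean_sq_le`): with `x_r` the site of offset `r` in the block `B^e(y)` (side `L^e = n+1`), `ȳ`
its corner, `v_r = V(Γ_{ȳ,x_r})` the comb transport and `V([x, x+te_μ])` the straight transport,
`L^{−ed}‖Σ_r R(v_r)f(x_r)‖² ≤ 2(L^{ed}L^{2e})^{−1}‖Σ_r Σ_{t<L^e} R(v_r·V([x_r, x_r+te_μ]))f(x_r + te_μ)‖² + 2L^e Σ_{s<L^e} Σ_r ‖(∇^V_μ f)(x_r + se_μ)‖²`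
— the block mean differs from the line-block average by the telescoped covariant derivatives along the contours (Cauchy–Schwarz).
[cite: Balaban1984PropagatorsI, (1.18) p.20; Balaban1985RegularSpaces, (1.1) p.76] -/
theorem blockMean_cov_le {V : GaugeField P i (Matrix (Fin N) (Fin N) ℂ)ˣ} (hV : ∀ b, V b ∈ U1 (Matrix (Fin N) (Fin N) ℂ))
    (hn : n + 1 = P.L ^ e) (y : Site P i') (μ : Fin P.d) (f : Site P i → Matrix (Fin N) (Fin N) ℂ) :
    (((n : ℝ) + 1) ^ P.d)⁻¹ *
        ‖∑ r : Fin P.d → Fin (n + 1), conjR (holT V (bsite P i e hn y fun _ => 0) (treeWord fun ν => ((r ν : ℕ) : ℤ))) (f (bsite P i e hn y r))‖ ^ 2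
      ≤ 2 * (((n : ℝ) + 1) ^ P.d * ((n : ℝ) + 1) ^ 2)⁻¹ *
          ‖∑ r : Fin P.d → Fin (n + 1), ∑ t ∈ range (n + 1),
              conjR (holT V (bsite P i e hn y fun _ => 0) (treeWord fun ν => ((r ν : ℕ) : ℤ))
                  * holT V (bsite P i e hn y r) (List.replicate t (μ, true)))
                (f ((fun z : Site P i => z.shift μ)^[t] (bsite P i e hn y r)))‖ ^ 2
        + 2 * ((n : ℝ) + 1) * ∑ s ∈ range (n + 1), ∑ r : Fin P.d → Fin (n + 1),
            ‖conjR (V ⟨(fun z : Site P i => z.shift μ)^[s] (bsite P i e hn y r), μ⟩) (f (((fun z : Site P i => z.shift μ)^[s] (bsite P i e hn y r)).shift μ))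
              - f ((fun z : Site P i => z.shift μ)^[s] (bsite P i e hn y r))‖ ^ 2 := by
  -- notation
  set M : ℕ := n + 1 with hM
  set Vol : ℝ := ((n : ℝ) + 1) ^ P.d with hVol
  set ybar : Site P i := bsite P i e hn y fun _ => 0 with hybar
  set x : (Fin P.d → Fin (n + 1)) → Site P i := fun r => bsite P i e hn y r with hx
  set v : (Fin P.d → Fin (n + 1)) → (Matrix (Fin N) (Fin N) ℂ)ˣ := fun r => holT V ybar (treeWord fun ν => ((r ν : ℕ) : ℤ)) with hv
  set τ : ℕ → Site P i → Site P i := fun s z => (fun z : Site P i => z.shift μ)^[s] z with hτ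
  set g : ℕ → (Fin P.d → Fin (n + 1)) → ℝ :=
    fun s r => ‖conjR (V ⟨τ s (x r), μ⟩) (f ((τ s (x r)).shift μ)) - f (τ s (x r))‖ with hg
  set F : (Fin P.d → Fin (n + 1)) → Matrix (Fin N) (Fin N) ℂ := fun r => conjR (v r) (f (x r)) with hF
  set S : Matrix (Fin N) (Fin N) ℂ := ∑ r, F r with hS
  set A : Matrix (Fin N) (Fin N) ℂ :=
    ∑ r, ∑ t ∈ range M, conjR (v r * holT V (x r) (List.replicate t (μ, true))) (f (τ t (x r))) with hA
  set ρ : ℝ := ∑ t ∈ range M, ∑ s ∈ range t, ∑ r, g s r with hρ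
  have hMR : (M : ℝ) = (n : ℝ) + 1 := by rw [hM]; push_cast; ring
  have hM0 : (0 : ℝ) < M := by rw [hMR]; positivity
  have hVol0 : 0 < Vol := by positivity
  have hcard : ((Finset.univ : Finset (Fin P.d → Fin (n + 1))).card : ℝ) = Vol := by
    rw [Finset.card_univ, Fintype.card_fun, Fintype.card_fin, Fintype.card_fin, hVol]; push_cast; ring
  -- (1) `A = M•S + R` with `‖R‖ ≤ ρ`
  have hAR : ‖A - M • S‖ ≤ ρ := by
    have hdec : A - M • S = ∑ r, ∑ t ∈ range M, conjR (v r)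
        (conjR (holT V (x r) (List.replicate t (μ, true))) (f (τ t (x r))) - f (x r)) := by
      have h1 : M • S = ∑ r, ∑ _t ∈ range M, F r := by
        rw [hS, Finset.smul_sum]
        refine Finset.sum_congr rfl fun r _ => ?_
        rw [Finset.sum_const, Finset.card_range]
      rw [h1, hA, ← Finset.sum_sub_distrib]
      refine Finset.sum_congr rfl fun r _ => ?_
      rw [← Finset.sum_sub_distrib]
      refine Finset.sum_congr rfl fun t _ => ?_
      rw [conjR_sub, conjR_conjR]
    rw [hdec]
    calc _ ≤ ∑ r, ‖∑ t ∈ range M, conjR (v r) (conjR (holT V (x r) (List.replicate t (μ, true))) (f (τ t (x r))) - f (x r))‖ := norm_sum_le _ _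
      _ ≤ ∑ r, ∑ t ∈ range M, ∑ s ∈ range t, g s r := by
          refine Finset.sum_le_sum fun r _ => (norm_sum_le _ _).trans (Finset.sum_le_sum fun t _ => ?_)
          rw [norm_conjR (holT_mem hV _ _)]
          exact norm_conjR_holT_replicate_sub_le hV f (x r) μ t
      _ = ρ := by
          rw [hρ, Finset.sum_comm]
          exact Finset.sum_congr rfl fun t _ => Finset.sum_comm
  -- (2) `M‖S‖ ≤ ‖A‖ + ρ`
  have hS_le : (M : ℝ) * ‖S‖ ≤ ‖A‖ + ρ := by
    have h1 : (M : ℝ) * ‖S‖ = ‖M • S‖ := (norm_nsmul_eq M S).symm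
    have h2 : ‖M • S‖ ≤ ‖A‖ + ‖A - M • S‖ := by
      have : M • S = A - (A - M • S) := by abel
      rw [this]
      exact (norm_sub_le _ _).trans (by rw [← this])
    linarith [hAR]
  -- (3) `ρ² ≤ M³·Vol·Σ_{s<M} Σ_r g_s(r)²`
  have hρsq : ρ ^ 2 ≤ (M : ℝ) ^ 3 * Vol * ∑ s ∈ range M, ∑ r, g s r ^ 2 := by
    have hB : ∀ t ∈ range M, (∑ s ∈ range t, ∑ r, g s r) ^ 2 ≤ (M : ℝ) * ∑ s ∈ range M, Vol * ∑ r, g s r ^ 2 := by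
      intro t ht
      have htM : t ≤ M := (Finset.mem_range.mp ht).le
      have c1 := sq_sum_le_card_mul_sum_sq (s := range t) (f := fun s => ∑ r, g s r)
      rw [Finset.card_range] at c1
      have c2 : ∑ s ∈ range t, (∑ r, g s r) ^ 2 ≤ ∑ s ∈ range M, Vol * ∑ r, g s r ^ 2 := by
        calc ∑ s ∈ range t, (∑ r, g s r) ^ 2
            ≤ ∑ s ∈ range M, (∑ r, g s r) ^ 2 :=
              Finset.sum_le_sum_of_subset_of_nonneg (Finset.range_subset_range.mpr htM) fun _ _ _ => sq_nonneg _
          _ ≤ ∑ s ∈ range M, Vol * ∑ r, g s r ^ 2 := Finset.sum_le_sum fun s _ => by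
              have c := sq_sum_le_card_mul_sum_sq (s := (Finset.univ : Finset (Fin P.d → Fin (n + 1)))) (f := fun r => g s r)
              rwa [hcard] at c
      have c3 : (0 : ℝ) ≤ ∑ s ∈ range M, Vol * ∑ r, g s r ^ 2 :=
        Finset.sum_nonneg fun s _ => mul_nonneg hVol0.le (Finset.sum_nonneg fun _ _ => sq_nonneg _)
      calc (∑ s ∈ range t, ∑ r, g s r) ^ 2 ≤ (t : ℝ) * ∑ s ∈ range t, (∑ r, g s r) ^ 2 := c1
        _ ≤ (M : ℝ) * ∑ s ∈ range M, Vol * ∑ r, g s r ^ 2 := by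
            have : (t : ℝ) ≤ M := by exact_mod_cast htM
            have c4 : (0 : ℝ) ≤ ∑ s ∈ range t, (∑ r, g s r) ^ 2 := Finset.sum_nonneg fun _ _ => sq_nonneg _
            nlinarith
    have c0 := sq_sum_le_card_mul_sum_sq (s := range M) (f := fun t => ∑ s ∈ range t, ∑ r, g s r)
    rw [Finset.card_range] at c0
    calc ρ ^ 2 ≤ (M : ℝ) * ∑ t ∈ range M, (∑ s ∈ range t, ∑ r, g s r) ^ 2 := c0
      _ ≤ (M : ℝ) * ∑ t ∈ range M, ((M : ℝ) * ∑ s ∈ range M, Vol * ∑ r, g s r ^ 2) :=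
          mul_le_mul_of_nonneg_left (Finset.sum_le_sum hB) hM0.le
      _ = (M : ℝ) ^ 3 * Vol * ∑ s ∈ range M, ∑ r, g s r ^ 2 := by
          rw [Finset.sum_const, Finset.card_range, nsmul_eq_mul, ← Finset.mul_sum]; ring
  -- (4) assemble: `Vol⁻¹‖S‖² ≤ 2(Vol M²)⁻¹‖A‖² + 2M Σ g²`
  have hρ0 : 0 ≤ ρ := Finset.sum_nonneg fun _ _ => Finset.sum_nonneg fun _ _ => Finset.sum_nonneg fun _ _ => norm_nonneg _
  have hSsq : ‖S‖ ^ 2 ≤ 2 * (‖A‖ ^ 2 + ρ ^ 2) / (M : ℝ) ^ 2 := by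
    rw [le_div_iff₀ (by positivity)]
    have h0 : 0 ≤ ‖S‖ := norm_nonneg _
    have hMS : 0 ≤ (M : ℝ) * ‖S‖ := by positivity
    have hsq := mul_le_mul hS_le hS_le hMS (add_nonneg (norm_nonneg _) hρ0)
    nlinarith [hsq, sq_nonneg (‖A‖ - ρ)]
  have hgoal : Vol⁻¹ * ‖S‖ ^ 2 ≤ 2 * (Vol * (M : ℝ) ^ 2)⁻¹ * ‖A‖ ^ 2 + 2 * M * ∑ s ∈ range M, ∑ r, g s r ^ 2 := by
    have h1 : Vol⁻¹ * ‖S‖ ^ 2 ≤ Vol⁻¹ * (2 * (‖A‖ ^ 2 + ρ ^ 2) / (M : ℝ) ^ 2) :=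
      mul_le_mul_of_nonneg_left hSsq (inv_pos.mpr hVol0).le
    have h2 : Vol⁻¹ * (2 * (‖A‖ ^ 2 + ρ ^ 2) / (M : ℝ) ^ 2)
        = 2 * (Vol * (M : ℝ) ^ 2)⁻¹ * ‖A‖ ^ 2 + 2 * ρ ^ 2 / (Vol * (M : ℝ) ^ 2) := by
      field_simp
    have h3 : 2 * ρ ^ 2 / (Vol * (M : ℝ) ^ 2) ≤ 2 * M * ∑ s ∈ range M, ∑ r, g s r ^ 2 := by
      rw [div_le_iff₀ (by positivity)]
      have hsum0 : (0 : ℝ) ≤ ∑ s ∈ range M, ∑ r, g s r ^ 2 := Finset.sum_nonneg fun _ _ => Finset.sum_nonneg fun _ _ => sq_nonneg _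
      nlinarith [hρsq, hM0, hVol0]
    linarith [h1, h2, h3]
  rw [hMR] at hgoal
  simpa only [hVol, hS, hF, hA, hg, hx, hv, hτ, hM] using hgoal

end LineAverage

end Summit.QuantumFields.YangMills.Theorems.Prop7CovariantCoercivity

end
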